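import Summits.ValiantsHypothesis.ValiantsHypothesis.Theorems.BarrierLeverTransversalMinorLayoutsFiniteCheck

/-!
# Route BarrierLever — item `TransversalSupportReduction` (stmt-ValiantsHypothesis-19932):
# TT at rank `r` reduces to lower-set pairs with FULL SUPPORT on one side

Helper file (`--supports stmt-ValiantsHypothesis-19932`; cell valiant-natproofs, rung V4, 𝒟-side of
door (c); seat val-np-p1 gen 8; item typed by planner p1-g13 after prover gen 8's HUB-MEMO §3
«finite-check principle»).  The item's signature, proved VERBATIM as `transversalSupportReduction`
(the by-name wrapper `theorem … : Theses.BarrierLever.TransversalSupportReduction` follows once the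
route file renders the declaration): for each `r`, if the TT layout matrix is nonsingular for
every pair of injective LOWER-SET layouts `u w : Fin r → Finset (Fin h)` with `h < r` one of which
uses every coordinate, then it is nonsingular for every injective pair `Fin r → Finset (Fin h)`,
every `h`.

Proof (three tree facts, no apex bookkeeping): induction on `h`; reduce to lower sets at fixed
`(h, r)` (`Compression.tt_sameSize_of_lowerSets`, val-np-p2); if neither side uses every
coordinate, delete an unused coordinate on each side (`LiteralLift.good_of_good_proj`, R2 without
side conditions, val-np-p1 g5; the deletions stay injective by
`Compression.proj_injective_of_const_bit`) and recurse; otherwise the full side has the `h + 1`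
distinct faces `∅, {a}` so `h < r` (`FiniteCheck.card_vertices_lt`) and the hypothesis applies.

WHAT THIS IS NOT: a reduction; nothing on TT (19152) itself, on crux stmt-ValiantsHypothesis-14610,
or on `VP` versus `VNP`.
-/

-- layout Summits/ValiantsHypothesis/ValiantsHypothesis forces the duplicated namespace component
set_option linter.dupNamespace false

open Matrix Finset

namespace Summit.ValiantsHypothesis.ValiantsHypothesis.Theorems.BarrierLever.FiniteCheck

open Summit.ValiantsHypothesis.ValiantsHypothesis.Theorems.BarrierLever.Compression
open Summit.ValiantsHypothesis.ValiantsHypothesis.Theorems.BarrierLever.LiteralLift (good_of_good_proj)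

/-- A full-support injective lower-set layout has more members than coordinates. -/
theorem height_lt_of_full {h r : ℕ} (u : Fin r → Finset (Fin h)) (hl : IsLowerSet (Set.range u))
    (hr : 0 < r) (hfull : ∀ a : Fin h, ∃ i, a ∈ u i) : h < r := by
  classical
  have hlt := card_vertices_lt u hl hr
  have e : (Finset.univ.filter fun a : Fin h => ∃ i, a ∈ u i) = Finset.univ :=
    Finset.filter_true_of_mem fun a _ => hfull a
  rw [e, Finset.card_univ, Fintype.card_fin] at hlt
  exact hlt

/-- **Item stmt-ValiantsHypothesis-19932 `TransversalSupportReduction`, signature VERBATIM.**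
For each rank `r`, TT for all injective `r`-row layout pairs at all heights follows from TT for
the injective LOWER-SET pairs at heights `h < r` with full support on one side. -/
theorem transversalSupportReduction :
    ∀ r : ℕ, (∀ (h : ℕ) (u w : Fin r → Finset (Fin h)), h < r → Function.Injective u →
      Function.Injective w → IsLowerSet (Set.range u) → IsLowerSet (Set.range w) →
      ((∀ a : Fin h, ∃ i, a ∈ u i) ∨ (∀ a : Fin h, ∃ j, a ∈ w j)) →
      ∃ H : Matrix (Fin (h + h)) (Fin (h + h)) ℂ, (Matrix.of fun i j : Fin r => (H.submatrix
        (fun a : Fin h => if a ∈ u i then Fin.castAdd h a else Fin.natAdd h a)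
        (fun c : Fin h => if c ∈ w j then Fin.natAdd h c else Fin.castAdd h c)).det).det ≠ 0) →
    ∀ (h : ℕ) (u w : Fin r → Finset (Fin h)), Function.Injective u → Function.Injective w →
      ∃ H : Matrix (Fin (h + h)) (Fin (h + h)) ℂ, (Matrix.of fun i j : Fin r => (H.submatrix
        (fun a : Fin h => if a ∈ u i then Fin.castAdd h a else Fin.natAdd h a)
        (fun c : Fin h => if c ∈ w j then Fin.natAdd h c else Fin.castAdd h c)).det).det ≠ 0 := by
  classical
  intro r hyp h
  -- rank 0 is trivial
  rcases Nat.eq_zero_or_pos r with hr0 | hrpos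
  · subst hr0
    intro u w _ _
    exact ⟨0, by simp [Matrix.det_isEmpty]⟩
  induction h with
  | zero =>
    intro u w hu hw
    refine tt_sameSize_of_lowerSets 0 r (fun u w hu hw hlu hlw => ?_) u w hu hw
    exact hyp 0 u w hrpos hu hw hlu hlw (Or.inl fun a => Fin.elim0 a)
  | succ n ih =>
    intro u w hu hw
    refine tt_sameSize_of_lowerSets (n + 1) r (fun u w hu hw hlu hlw => ?_) u w hu hw
    by_cases hfull : (∀ a : Fin (n + 1), ∃ i, a ∈ u i) ∨ (∀ a : Fin (n + 1), ∃ j, a ∈ w j)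
    · have hlt : n + 1 < r := by
        rcases hfull with hf | hf
        · exact height_lt_of_full u hlu hrpos hf
        · exact height_lt_of_full w hlw hrpos hf
      exact hyp (n + 1) u w hlt hu hw hlu hlw hfull
    · rw [not_or] at hfull
      obtain ⟨h1, h2⟩ := hfull
      push Not at h1 h2
      obtain ⟨a, ha⟩ := h1
      obtain ⟨c, hc⟩ := h2
      refine good_of_good_proj n r u w a c (ih _ _ ?_ ?_)
      · exact proj_injective_of_const_bit u hu a false (fun i => by simp [ha i])
      · exact proj_injective_of_const_bit w hw c false (fun j => by simp [hc j])

end Summit.ValiantsHypothesis.ValiantsHypothesis.Theorems.BarrierLever.FiniteCheck
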